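import Literature.AlgebraicGeometry.HodgeTheory.HodgeConjecture
import HarnessLib
import HarnessLib.Audit
import HarnessLib.Audit.TribunalTags

/-!
# Strong-Hypothesis Library — summit `HodgeConjecture` (D-0034, skeleton)

The REGISTRY of known strong hypotheses `H` (open conjectures with `H ⇒ P` landed or printed) and of
known EQUIVALENT REFORMULATIONS `E` (`E ↔ P` landed or printed) for the single-problem summit
`HodgeConjecture`. Tag key `"HodgeConjecture.HodgeConjecture"`. The kernel tribunal (`#h21_tribunal`,
D-0033 T1 rule (a)) probes every registered `H` against a route crux `C` for `H → C`; the bridges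
`H → P` / `H ↔ P` live summit-side in `Summits/HodgeConjecture/StrongHypotheses.lean`.

## The problem

* `HodgeConjecture` (root decl, `Summits/HodgeConjecture/HodgeConjecture/Statement.lean`,
  `[problem: hodge]`): for every smooth projective geometrically irreducible `X` of dimension `n` over
  `ℂ` (`Literature.AlgebraicGeometry.Motives.IsSmoothProjective n X`), the Literature statement
  `Literature.AlgebraicGeometry.HodgeTheory.HodgeConjectureFor n X`: `X` has a Hodge model and every
  RATIONAL class `c ∈ H²ᵖ(X(ℂ); ℂ)` (`IsRationalClass`) of Hodge type `(p, p)` (`IsOfHodgeType`) lies in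
  `algebraicClasses X p = Nᵖ H²ᵖ(X(ℂ); ℂ)` (Deligne, Clay 2000, §1). All carriers are REAL (singular
  cohomology of the complex points); this matters below: most conjectures of the motivic layer
  (`Literature/AlgebraicGeometry/Motives`) are predicates on ABSTRACT hypothesis structures
  (`WeilCohomology`, `BettiHodgeData`, `NoriMotivicInterface`) and have no printed or landed bridge to
  the real-carrier statement.

## Census (skeleton; 2026-08-17)

Abbreviations: `SC` = `Summit.HodgeConjecture.HodgeConjecture.Cruxes.SectorComplement.StrategyCensus.NikulinTwinTransport`
(file `Summits/HodgeConjecture/HodgeConjecture/Cruxes/SectorComplement/StrategyCensus13684.lean`, a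
BUILT Cruxes file — not a Theses file — whose closed `Prop`s are typed with the real-carrier Literature
vocabulary `StandardConjectureBStar`, `motivatedClasses`, `IsWeaklyAbsoluteHodgeClass`, `baseChangeHom`);
`HT` = `Literature.AlgebraicGeometry.HodgeTheory`; `Mo` = `Literature.AlgebraicGeometry.Motives`;
`Ba` = `Literature.Barriers.HodgeConjecture`.

| # | `H` / `E` | one-line statement | relation to `P` | source | status here | bridge |
|---|---|---|---|---|---|---|
| 1 | middle-degree reduction `SC.MiddleAll` | every rational `(m,m)`-class on every smooth projective `2m`-fold is algebraic | EQUIVALENT (landed) | classical Lefschetz reduction; Brosnan–Fang–Nie–Pearlstein 2009, Lemma 48 (products with `ℙᵏ` below the middle, linear sections + weak Lefschetz above) | `registered` (summit-side decl, tagged in the summit file) | landed: `Summit.HodgeConjecture.StrongHypotheses.middleAll_iff_hodgeConjecture` (= `SC.hodgeConjecture_iff_middleAll.symm`) |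
| 2 | André's motivated package `SC.MotivatedSummit := SC.LefschetzBAll ∧ SC.HodgeIsMotivatedAll` | Grothendieck's standard conjecture `B(Z)` (Lefschetz involution algebraic, `HT.StandardConjectureBStar`) for ALL smooth projective complex `Z`, AND every rational `(p,p)`-class is an André motivated class (`HT.motivatedClasses`) | EQUIVALENT in print: `⇒ P` André 1996 §0.3 / §2.1 remark ("`A_mot(X) = A(X)` si … `*_L` est donnée par une correspondance algébrique"); `P ⇒ HodgeIsMotivatedAll` LANDED (`SC.hodgeIsMotivatedAll_of_hodgeConjecture`); `P ⇒ B(X)` over `ℂ` classical (the Lefschetz/Künneth operators are Hodge classes on `X × X`; Kleiman 1994, locator not re-read for this skeleton) — not in tree | André, Publ. IHÉS 83 (1996) §0.3–0.4, §2.1 | `registered` (summit-side decl, tagged in the summit file) | printed: `Summit.HodgeConjecture.StrongHypotheses.MotivatedSummitImpliesHodgeConjecture` (in tree CONDITIONALLY: `SC.hodgeConjecture_of_motivatedSummit` over the named fact `HT.Andre1996_motivatedClasses_le_algebraicClasses_of_standardConjectureB`, itself reduced to `HT.Voisin2003_cupProduct_algebraicClasses` by `HT.…_holds_of` in `HT/MotivatedClassesAssembly`)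 |
| 3 | Voisin's `ℚ̄`-package `SC.QbarSummit` | `HodgeConjectureFor` for every complex base change of a smooth projective `ℚ̄`-variety, AND every rational `(p,p)`-class on every smooth projective complex variety is weakly absolute Hodge (`HT.IsWeaklyAbsoluteHodgeClass`) | EQUIVALENT in print: `⇒ P` Voisin 2007 Prop. 1.2 (with Def. 2.1, Rem. 1.4); `P ⇒` first conjunct is a slice (landed `SC.qbarSummit_fst_of_hodgeConjecture`), `P ⇒` second conjunct by "algebraic classes are absolute Hodge" (Deligne 1982, 2.1(a)) — not in tree | Voisin, Compos. Math. 143 (2007) Prop. 1.2 / Thm. 0.5 | `registered` (summit-side decl, tagged in the summit file) | printed: `Summit.HodgeConjecture.StrongHypotheses.QbarSummitImpliesHodgeConjecture` (in tree CONDITIONALLY: `SC.hodgeConjecture_of_qbarSummit` over the named fact `HT.voisin2007_hodgeConjecture_weaklyAbsolute_of_qbar`) |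
| 4 | Grothendieck's amended GENERALIZED Hodge conjecture | every rational sub-Hodge structure of `Hⁱ(X, ℚ)` of level `≤ i - 2r` lies in `Nʳ Hⁱ` | STRICTLY STRONGER (its case `(i, r) = (2p, p)` is `P`: Grothendieck 1969 p. 301) | Grothendieck, Topology 8 (1969) pp. 300–301; Voisin I Conj. 11.37 | `not typeable` on the real carriers here (missing notion: rational sub-Hodge structures / level of the real carrier `HT.complexBetti X i` with `IsRationalClass`; the tree's rendering `Mo.GeneralizedHodgeConjecture (B : Mo.BettiHodgeData ℂ)` / `Mo.BettiHodgeData.GeneralizedHodgeConjectureFor` is a predicate on an ABSTRACT Betti–Hodge datum with no constructed instance and no bridge to `P`) | none |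
| 5 | Grothendieck's standard conjecture of Lefschetz type alone, `SC.LefschetzBAll` (per-`(Z, η)`: `HT.StandardConjectureBStar`; abstract: `Mo.WeilCohomology.StandardConjectureB/BΛ/Hdg`, `Mo.….LefschetzStandardConjecture`, `HT.StandardConjectureA`, `Mo.….StandardConjectureA`) | `*_L` (equivalently `Λ`) is an algebraic correspondence for every polarised smooth projective complex `Z` | CONSEQUENCE of `P` over `ℂ` (Kleiman 1994; Grothendieck 1968 §3), NOT known to imply `P` | Grothendieck, Bombay 1968 §3; Kleiman 1968, 1994 | deliberately NOT registered (wrong direction; the abstract forms are moreover parametrised over a Weil cohomology `W`) | — |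
| 6 | "every Hodge class is motivated" alone, `SC.HodgeIsMotivatedAll` | rational `(p,p)`-classes lie in `A_motᵖ(X)_ℂ` | CONSEQUENCE of `P` (landed `SC.hodgeIsMotivatedAll_of_hodgeConjecture`); `⇒ P` only together with `B` (row 2) | André 1996 Thm. 0.6.2 (abelian varieties), §0.4 | deliberately NOT registered (wrong direction) | — |
| 7 | Tate conjecture (`Mo.TateConjecture ℓ`, `Mo.GaloisRealization….TateConjectureFor X p`, `Mo.….TateSemisimplicityFor`) and Mumford–Tate conjecture (`Mo.MumfordTateConjecture`, `Mo.MumfordTateConjectureFor`) | `ℓ`-adic Tate classes are algebraic / the Mumford–Tate group is the Zariski closure of the Galois image | INCOMPARABLE with `P` in print: Tate ⇒ Hodge only for abelian varieties (Pjateckiĭ-Šapiro 1971; Deligne 1982 via absolute Hodge classes, Milne); Mumford–Tate gives `Hodge ⇔ Tate` per variety over a number field; no printed `Tate ⇒ P` for all `X` | Tate 1965/1994; Deligne 1982; Mumford 1966 | deliberately NOT registered (no `H ⇒ P` in print; decls parametrised over the ground field, `ℓ`, and a `HodgeTensorFacts` class) | — |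
| 8 | Grothendieck period conjecture (`Mo.NoriMotivicInterface.GrothendieckPeriodConjecture m`, `…Trdeg`, `Mo.….GPCForAll N`; route decl `Summit.….Theses.PeriodsPolice.GrothendieckPeriodConjecture`) | `trdeg_ℚ` of the periods of a motive over `ℚ̄` = dimension of its motivic Galois group | NOT known to imply `P`: its printed Hodge-type consequences concern varieties over `ℚ̄` and need `B` and a `ℚ̄`-descent in addition (exactly the assembly of route `PeriodsPolice`); parametrised over an abstract Nori interface | Grothendieck 1966; André 2004 ch. 7, 23; Huber–Müller-Stach 2017 ch. 13 | deliberately NOT registered (no `H ⇒ P` in print; abstract-interface predicate; the route copy is a Theses decl) | — |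
| 9 | variational Hodge conjecture | a flat section of `R²ᵖ f_* ℚ` algebraic at one fibre is algebraic at every fibre | classical VHC (Grothendieck 1966) is a CONSEQUENCE of `P`; the tree's route form `Summit.….Theses.AnchorTransport.VariationalHodge` is EQUIVALENT to `P` given `AnchorExistence` and `HodgeModels` (landed `Summit.….Theorems.anchorTransport_variationalHodge_iff_hodgeConjecture_of_anchorExistence`) | Grothendieck 1966 (footnote 13) | NOT registered: the only closed decl is a Theses decl (tagging route cruxes is circular); no Literature real-carrier statement | — |
| 10 | Hodge conjecture for abelian varieties (`Summit.….Cruxes.SummitOffWeilSector.Disproof.HodgeConjectureForAbelianVarieties`; Weil-class forms) | `HodgeConjectureFor A.dim A.X` for every complex abelian variety | WEAKER special case (`abelian_to_all_of_summitOffWeilSector : SummitOffWeilSector → HC_ab → P` shows the missing piece is a route crux) | Weil 1977; Moonen–Zarhin 1999; André 1996 Thm. 0.6.2 | deliberately NOT registered (not a bridge toward `P`) | — |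

REFUTED strengthenings (recorded so that no seat registers them; all are catalogued barriers, BUILT):
* INTEGRAL Hodge conjecture — false (Atiyah–Hirzebruch 1962 torsion classes; Kollár 1992 non-torsion):
  `Ba.AtiyahHirzebruch1962_torsionClass_notAlgebraic`, `Ba.Kollar1992_nonTorsionClass_notAlgebraic`
  (`Barriers/HodgeConjecture/IntegralCoefficients`); the per-variety predicate
  `Mo.BettiHodgeData.IntegralHodgeConjectureFor` is abstract-datum parametrised. Deligne 2000 §2 (iv).
* Hodge's ORIGINAL general conjecture `Nᵖ Hⁱ(X, ℚ) = Hⁱ(X, ℚ) ∩ Fᵖ` — false for trivial reasons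
  (Grothendieck 1969): `Ba.Grothendieck1969_generalHodgeConjecture_false`, PROVED in tree
  (`Ba.Grothendieck1969_generalHodgeConjecture_false_holds`, `Barriers/HodgeConjecture/GeneralizedHodgeTrivialReasonsHolds`).
* KÄHLER Hodge conjecture (all three coherent-sheaf forms) — false (Zucker 1977; Voisin 2002):
  `Ba.Zucker1977_kaehlerTorus_noAnalyticCycles`, `Ba.Voisin2002_weilTorus_hodgeClassWithoutSubvarieties`
  (`Barriers/HodgeConjecture/KaehlerCounterexamples`, `…/KaehlerCoherentSheaves`). Deligne 2000 §2 (v).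
* Demailly's `HC⁺` (strongly positive currents are limits of effective cycles) — false (Babaee–Huh 2017):
  `Ba.BabaeeHuh2017_HCplus_false` (`Barriers/HodgeConjecture/PositiveCurrents`).

## Deliberately NOT registered here (Literature side), and why

* This Literature file tags NOTHING in place and states NO new hypothesis: every closed `Prop` that is
  known (landed or printed) to imply the real-carrier summit lives SUMMIT-SIDE (rows 1–3, the Cruxes
  strategy-census file `SC`), where the summit bridge file tags it; the Literature-side conjectures of
  the motivic layer are either parametrised predicates over abstract realisation data (rows 4, 5, 7, 8;
  closing them over "all data" would be vacuous or junk — no instance of `BettiHodgeData ℂ` /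
  `NoriMotivicInterface` is constructed in the tree) or point in the wrong direction (rows 5, 6, 10).
  The two closures one could spend (`∀ Z η, StandardConjectureBStar …`, "all Hodge classes motivated")
  already exist summit-side as `SC.LefschetzBAll`, `SC.HodgeIsMotivatedAll` and are consequences of
  `P`, not strong hypotheses — so the ≤ 2 new-decl budget of the skeleton is left unspent (0 new decls).
* Landed real-carrier EQUIVALENTS of `P` that are NOT registered because they are slices or
  re-cuttings of ROUTE decls (Theses; tagging them would make the tribunal circular):
  `Summit.….Cruxes.SectionalSource.Census.Critical` / `TailFrom p₀` (`↔ P`, slices of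
  `Theses.AmpleAdicLefschetz.SectionalSource`), `Theses.AnchorTransport.AnchorExistence` and its Cruxes re-cutting
  `Cruxes.AnchorExistence.Disproof.AnchorExistenceDistinct` (`↔ P`),
  `Theses.PadicSemiregularLift.HodgeBeyondAnchors` (`↔ P`), `Theses.HolomorphicityRate.RateGap` (`↔ P`),
  `Theses.TropicalCuspLift.Assembly` (`↔ P`), `Theses.HeckeOrbitCompactness.Assembly` (`↔ P`).
* `Summit.….Theorems.MiddleStepFor (fun X ↦ ¬ ChowZeroDegenerate X)` — `P ↔` "middle-degree step for
  `CH₀`-non-degenerate `2q`-folds" (landed `Summit.….Theorems.hodgeConjecture_iff_heart`, Voisin II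
  Thm. 10.17 / Prop. 10.26 over Bloch–Srinivas) is an APPLIED parametrised predicate; its closure is a
  worthwhile follow-up registration (one `def`, summit-side) but is not spent in this skeleton.

## References

[Deligne2000] §1–2; [Andre1996Motifs] §0.3–0.4, §2.1, Thm. 0.5, 0.6.2; [Voisin2007HodgeLoci] Prop. 1.2,
Def. 2.1, Thm. 0.5; [BrosnanFangNiePearlstein2009] Lemma 48; [Kleiman1994StandardConjectures];
[Grothendieck1968] §3; [GrothendieckTopology1969] pp. 299–302; [Deligne1982HodgeCycles] §2;
[VoisinHodgeI2002] §11.3; [VoisinHodgeII2003] §9.2, §10.2–10.3; [AtiyahHirzebruch1962]; [Zucker1977];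
[Voisin2002KaehlerCounterexample]; [BabaeeHuh2017]; [Andre2004] ch. 7; [Tate1994] §1.
-/

namespace Literature.StrongHypotheses.HodgeConjecture

/-! Registry: no Literature-side entries (see the census above); the three registered hypotheses are
summit-side decls tagged in `Summits/HodgeConjecture/StrongHypotheses.lean`. -/

end Literature.StrongHypotheses.HodgeConjecture
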